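import Summits.MatrixMultiplication.MatrixMultiplication.Theorems.AbelianSTPPCensusTALin1200Defs

/-!
# T_A/1200 certificate: kernel evaluation, volumes `301 … 400` (segments 7 and 8)

Cell mm-stpp (rung F-M1), T_A/1200 = «no abelian STPP host of order `≤ 1200` beats `τ = 2.371`»; checker and checkpoint states in
`AbelianSTPPCensusTALin1200Defs.lean` (linear one-pass certificate: vM densities + the Grynkiewicz budget of the maximal member).  `decide` with
kernel reduction (standard axioms; no `native_decide`; ≈ 2–3 min per 50-volume segment on the farm).  Each segment recomputes the next checkpoint
state from the previous one and checks every sorted candidate shape of its volumes at every order `576 … 1200`; consumed by `TALin1200.seg_sound` /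
`TALin1200.loopL_sound` in `AbelianSTPPCensusLeafTA1200Closed.lean`.
WHAT THIS IS NOT: arithmetic on shape lists only; no statement about STPP families or `ω`.
-/

set_option linter.dupNamespace false
set_option autoImplicit false

namespace Summit.MatrixMultiplication.MatrixMultiplication.Theorems.TALin1200

set_option maxHeartbeats 0 in
/-- Segment 7: volumes `301 … 350` from `st300` reach the checkpoint `st350`, all checks at orders `576 … 1200` passing. [original] -/
theorem seg7 : loopL 576 625 50 301 st300 = (true, st350) := by decide +kernel

set_option maxHeartbeats 0 in
/-- Segment 8: volumes `351 … 400` from `st350` reach the checkpoint `st400`, all checks at orders `576 … 1200` passing. [original] -/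
theorem seg8 : loopL 576 625 50 351 st350 = (true, st400) := by decide +kernel

end Summit.MatrixMultiplication.MatrixMultiplication.Theorems.TALin1200
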